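import Mathlib
import HarnessLib
import Literature.Analysis.FluidPDE.Tao2016AveragedNS.LocalCascadeSolutions
import Literature.Analysis.FluidPDE.Tao2016AveragedNS.RenormalisedCascadeWaves
import Literature.Analysis.FluidPDE.Tao2016AveragedNS.SelfSimilarCascadeBlowup
import Literature.Analysis.FluidPDE.Tao2016AveragedNS.ViscousEternalSolutions
import Literature.Analysis.FluidPDE.Tao2016AveragedNS.BoundedEternalSolutions
import Summits.NavierStokesRegularity.NavierStokesRegularity.Theses.TaoLadderRungTwoBreak
import Summits.NavierStokesRegularity.NavierStokesRegularity.Theorems.TaoLadderRungTwoBreakNoSurvivingEternalViscBddOneSmallActionRung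
import Summits.NavierStokesRegularity.NavierStokesRegularity.Theorems.TaoLadderRungTwoBreakNoSurvivingEternalViscBddOneSurvivorEnergyBound

/-!
# The BLOCK RESIDUE FLOOR for uniformly bounded admissible eternal solutions — helper toward K1ᵛ(1)
# `TaoLadderRungTwoBreak.NoSurvivingEternalViscBddOne` (stmt-NavierStokesRegularity-20419), any `ν̂ ≥ 0`, no sign assumption

MODEL lattice ODEs only (Tao 2016 §4 in the log-time variables of §6.4; cell vocabulary `IsEternalVisc`, `UniformBound`,
`physEnergy`, `physFlux`, `viscCoef`); nothing here is a statement about the Navier–Stokes equations; no stub, crux, rung or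
summit is proved (`--supports stmt-NavierStokesRegularity-20419`).  General `m`, every CANCELLING table, every `ε₀ > 0`, every
`ν̂ ≥ 0` ((ρ0) and (ρ+) at once); `E_k = physEnergy`, `F_k = physFlux`, `C_A = fluxConst α`, `Λ = bigLam ε₀`, `κ₀ = 2C_AΛ⁻¹`.

The single-shell residue floor `…ResidueFloor.physEnergy_ge_residueFloor` carries an ADDITIVE back-flow term of the order of the
action (the obstruction recorded in the census of ⟨20419⟩).  Passing to a BLOCK `N+1, …, N+M` internalises the back-flow: the
interior fluxes telescope by (4.3) (tree `hasDerivAt_tail`), the block dissipation is at most the TOP coefficient times the block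
(`blockDiss_le_top`), the top flux is `≤ κ₀‖W_{N+M+1}‖·(block)`.  Results (the lower-bound twin of `…TailConveyor.tailSum_le`):
* `blockEnergy_ge_floor` — **`Σ_{j<M}E_{N+1+j}(σ) ≥ e^{−Θ}·Σ_{j<M}E_{N+1+j}(σ⋆) − Φ`** (`σ⋆ ≤ σ`), `Θ ≥ ∫_{σ⋆}^{σ}(κ₀‖W_{N+M+1}‖ +
  2·visc_{N+M})` (drain through the ONE bond above + top dissipation rate), `Φ ≥ ∫_{σ⋆}^{σ}|F_N|` (traffic through the ONE bond
  below) — no interior term: energy handed back down INSIDE the block is not lost to the block;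
* `integral_abs_physFlux_late_le` / `integral_two_viscCoef_le` — LATE STARVATION above shell `0` under the uniform energy bound
  `E_n ≤ K` (tree `exists_uniform_physEnergy_le`): `∫_{σ₁}^{σ₂}|F_N| ≤ 2C_AΛ^N K√K e^{−σ₁}`, `∫_{σ₁}^{σ₂}2·visc_k ≤ 2ν̂(1+ε₀)^{2k}e^{−σ₁}`;
* `blockEnergy_late_ge` / `blockEnergy_late_ge_of_action` — **NO BLOCK EVER EMPTIES**: for `N, M ∈ ℕ`, `σ₁ ≤ σ₂`,
  `Σ_{j<M}E_{N+1+j}(σ₂) ≥ exp(−(κ₀a + 2ν̂(1+ε₀)^{2(N+M)}e^{−σ₁}))·Σ_{j<M}E_{N+1+j}(σ₁) − 2C_AΛ^N K√K e^{−σ₁}`, `a` the action of the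
  ONE shell `N+M+1` on `[σ₁,σ₂]` (or the admissibility budget `∫_ℝ‖W_n‖ ≤ 𝓜`, uniformly in `σ₂`); `blockTerminal_ge` — the same
  floor for any limit of the block energy (the frozen block wake);
* `survivalEvent_blockWake` — **a survival event never evaporates**: `p_n(σ) = physWeight(1)^n e^{2σ}‖W_n(σ)‖² ≥ c` at `n ≥ 1`
  forces `Σ_{1≤k≤n}E_k(σ₂) ≥ exp(−(κ₀𝓜 + 2ν̂(1+ε₀)^{2n}e^{−σ}))·c(1+ε₀)^{−n} − 2C_A K√K e^{−σ}` for EVERY `σ₂ ≥ σ` (the sign-coherent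
  class had a per-shell wake floor, `…WakeEquivalence.wakeFloor_of_survivingFwd`; this block form needs no sign).
READING for ⟨20419⟩: on a general (backscattering) table the energy a survivor shows at `(n, σ)` stays below the bond `n → n+1`
up to the factor `e^{−κ₀𝓜}` and the starvation error; (ρ0)/(ρ+) must rule out not its disappearance but its DISTRIBUTION over the
shells `≤ n` with `p_k → 0` — the wake-distribution / selection problem named by hands g9–g11.  HONEST LABEL: a-priori block
estimate; `stub_noSurvivingEternalBddOne`, `stub_noLoudLadderOne`, ⟨20419⟩ and every NS statement remain OPEN; rung 0.
-/

noncomputable section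

-- the summit and its single sub-problem share the name (CONVENTIONS §1)
set_option linter.dupNamespace false

namespace Summit.NavierStokesRegularity.NavierStokesRegularity.Theorems.NoSurvivingEternalViscBddOne.BlockResidueFloor

open Set Filter Topology MeasureTheory
open scoped RealInnerProductSpace
open Literature.Analysis.FluidPDE Literature.Analysis.FluidPDE.TaoCascade
open Summit.NavierStokesRegularity.NavierStokesRegularity.Theses.TaoLadderRungTwoBreak
open Summit.NavierStokesRegularity.NavierStokesRegularity.Theorems.NoSurvivingEternalViscBddOne.SmallAction
open Summit.NavierStokesRegularity.NavierStokesRegularity.Theorems.NoSurvivingEternalViscBddOne.SurvivorEnergyBound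

variable {m : ℕ} {ε₀ νh : ℝ} {α : Fin m → Fin m → Fin m → ℤ × ℤ × ℤ → ℝ} {W : ℤ → ℝ → Em m}

/-! ## §1 The block: dissipation is dominated by the top shell, the top shell by the block -/

/-- The covariant viscosity coefficient `ν̂(1+ε₀)^{2k}e^{−σ}` is non-decreasing in the shell index (`ε₀ ≥ 0`, `ν̂ ≥ 0`).
[cite: Tao2016AveragedNS, §4, the viscous equation displayed before Thm. 4.2, in the variables of §6.4; elementary] -/
theorem viscCoef_mono_shell (hε : 0 ≤ ε₀) (hν : 0 ≤ νh) {k k' : ℤ} (hkk : k ≤ k') (σ : ℝ) :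
    viscCoef ε₀ νh k σ ≤ viscCoef ε₀ νh k' σ := by
  unfold viscCoef
  refine mul_le_mul_of_nonneg_left ?_ hν
  refine mul_le_mul_of_nonneg_right ?_ (Real.exp_pos _).le
  refine Real.rpow_le_rpow_of_exponent_le (by linarith) ?_
  have : (k : ℝ) ≤ (k' : ℝ) := by exact_mod_cast hkk
  linarith

/-- **Block dissipation is at most the top coefficient applied to the whole block**:
`Σ_{j<M} 2·visc_{N+1+j}·E_{N+1+j} ≤ 2·visc_{N+M}·Σ_{j<M}E_{N+1+j}`.
[cite: Tao2016AveragedNS, §4, the viscous equation displayed before Thm. 4.2, §6.4; elementary] -/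
theorem blockDiss_le_top (hε : 0 < ε₀) (hν : 0 ≤ νh) (W : ℤ → ℝ → Em m) (N : ℤ) (M : ℕ) (σ : ℝ) :
    ∑ j ∈ Finset.range M, 2 * viscCoef ε₀ νh (N + 1 + j) σ * physEnergy ε₀ W (N + 1 + j) σ
      ≤ 2 * viscCoef ε₀ νh (N + M) σ * ∑ j ∈ Finset.range M, physEnergy ε₀ W (N + 1 + j) σ := by
  rw [Finset.mul_sum]
  refine Finset.sum_le_sum fun j hj => ?_
  have hjM : j < M := Finset.mem_range.1 hj
  refine mul_le_mul_of_nonneg_right ?_ (physEnergy_nonneg _ _ _ _)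
  refine mul_le_mul_of_nonneg_left ?_ two_pos.le
  refine viscCoef_mono_shell hε.le hν ?_ σ
  have : (j : ℤ) + 1 ≤ (M : ℤ) := by exact_mod_cast hjM
  linarith

/-- The top shell of a non-empty block is dominated by the block: `E_{N+M} ≤ Σ_{j<M}E_{N+1+j}` (`M ≥ 1`).
[cite: Tao2016AveragedNS, §4 Lemma 4.1 (4.10), §6.4; elementary] -/
theorem top_physEnergy_le_block (W : ℤ → ℝ → Em m) (N : ℤ) {M : ℕ} (hM : 1 ≤ M) (σ : ℝ) :
    physEnergy ε₀ W (N + M) σ ≤ ∑ j ∈ Finset.range M, physEnergy ε₀ W (N + 1 + j) σ := by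
  have hmem : M - 1 ∈ Finset.range M := Finset.mem_range.2 (by omega)
  have heq : physEnergy ε₀ W (N + M) σ = physEnergy ε₀ W (N + 1 + ((M - 1 : ℕ) : ℤ)) σ := by
    congr 1
    have : ((M - 1 : ℕ) : ℤ) = (M : ℤ) - 1 := by omega
    rw [this]; ring
  rw [heq]
  exact Finset.single_le_sum (s := Finset.range M) (f := fun j : ℕ => physEnergy ε₀ W (N + 1 + (j : ℤ)) σ)
    (fun i _ => physEnergy_nonneg ε₀ W _ σ) hmem

/-! ## §2 The block residue floor -/

/-- **THE BLOCK RESIDUE FLOOR.**  For an admissible eternal solution (any `ν̂ ≥ 0`) of a cancelling table, a block of shells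
`N+1, …, N+M`, log-times `σ⋆ ≤ σ`, a bound `Θ ≥ ∫_{σ⋆}^{σ}(2C_AΛ⁻¹‖W_{N+M+1}‖ + 2·visc_{N+M})` of the drain rate through the
bond ABOVE the block (plus the top dissipation rate) and a bound `Φ ≥ ∫_{σ⋆}^{σ}|F_N|` of the traffic through the bond BELOW it:
`e^{−Θ}·Σ_{j<M}E_{N+1+j}(σ⋆) − Φ ≤ Σ_{j<M}E_{N+1+j}(σ)`.  Interior (back-)fluxes telescope by (4.3) and do not appear.
[cite: Tao2016AveragedNS, §4 Lemma 4.1 (4.8)–(4.10) with (4.3), the viscous equation before Thm. 4.2, §6.4; tree `hasDerivAt_tail`, `abs_physFlux_le` + this file] -/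
theorem blockEnergy_ge_floor (hε : 0 < ε₀) (hW : IsEternalVisc ε₀ νh α W) (hc : IsCancellingCoeff α)
    (N : ℤ) (M : ℕ) {σs σ : ℝ} (hle : σs ≤ σ) {Θ Φ : ℝ}
    (hΘ : ∫ s in σs..σ, (2 * fluxConst α * (bigLam ε₀)⁻¹ * ‖W (N + M + 1) s‖
      + 2 * viscCoef ε₀ νh (N + M) s) ≤ Θ)
    (hΦ : ∫ s in σs..σ, |physFlux ε₀ α W N s| ≤ Φ) :
    Real.exp (-Θ) * (∑ j ∈ Finset.range M, physEnergy ε₀ W (N + 1 + j) σs) - Φ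
      ≤ ∑ j ∈ Finset.range M, physEnergy ε₀ W (N + 1 + j) σ := by
  set κ₀ := 2 * fluxConst α * (bigLam ε₀)⁻¹ with hκ₀
  have hΛ : 0 < bigLam ε₀ := bigLam_pos (by linarith)
  have hκ₀nn : 0 ≤ κ₀ := by have := fluxConst_nonneg α; positivity
  have hν : 0 ≤ νh := hW.nonneg
  set T : ℝ → ℝ := fun x => ∑ j ∈ Finset.range M, physEnergy ε₀ W (N + 1 + j) x with hT
  have hTnn : ∀ x, 0 ≤ T x := fun x => Finset.sum_nonneg fun j _ => physEnergy_nonneg ε₀ W _ x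
  have cWtop : Continuous (W (N + M + 1)) :=
    continuous_iff_continuousAt.2 fun s => (hW.law (N + M + 1) s).continuousAt
  have cvisc : Continuous fun s => viscCoef ε₀ νh (N + M) s := by unfold viscCoef; fun_prop
  have cFN : Continuous (physFlux ε₀ α W N) := continuous_physFlux hW hc N
  have cFtop : Continuous (physFlux ε₀ α W (N + M)) := continuous_physFlux hW hc (N + M)
  have cE : ∀ k : ℤ, Continuous (physEnergy ε₀ W k) := fun k => continuous_physEnergy hW k
  have hΦ0 : 0 ≤ Φ := le_trans (intervalIntegral.integral_nonneg hle fun s _ => abs_nonneg _) hΦ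
  rcases Nat.eq_zero_or_pos M with hM0 | hM1
  · subst hM0; simp only [Finset.range_zero, Finset.sum_empty, mul_zero, zero_sub]; linarith
  set θ : ℝ → ℝ := fun s => κ₀ * ‖W (N + M + 1) s‖ + 2 * viscCoef ε₀ νh (N + M) s with hθ
  have cθ : Continuous θ := by simp only [hθ]; fun_prop
  have hθnn : ∀ s, 0 ≤ θ s := fun s =>
    add_nonneg (mul_nonneg hκ₀nn (norm_nonneg _)) (mul_nonneg two_pos.le (viscCoef_nonneg hε hν _ s))
  set P : ℝ → ℝ := fun u => ∫ x in σs..u, θ x with hP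
  have hPderiv : ∀ u, HasDerivAt P (θ u) u := fun u => (cθ.integral_hasStrictDerivAt σs u).hasDerivAt
  have cP : Continuous P := continuous_iff_continuousAt.2 fun u => (hPderiv u).continuousAt
  have hP0 : P σs = 0 := by simp [hP]
  have hPmono : ∀ s ∈ Icc σs σ, P s ≤ P σ := by
    intro s hs
    have h := intervalIntegral.integral_mono_interval (μ := volume) (f := θ) (c := σs) (d := σ) (a := σs)
      (b := s) le_rfl hs.1 hs.2 (Eventually.of_forall fun x => hθnn x) (cθ.intervalIntegrable _ _)
    simpa [hP] using h
  have hPσ : P σ ≤ Θ := hΘ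
  set D : ℝ → ℝ := fun s => physFlux ε₀ α W N s - physFlux ε₀ α W (N + M) s
      - ∑ j ∈ Finset.range M, 2 * viscCoef ε₀ νh (N + 1 + j) s * physEnergy ε₀ W (N + 1 + j) s with hD
  have hTderiv : ∀ s, HasDerivAt T (D s) s := fun s => hasDerivAt_tail hε hW hc N M s
  have cD : Continuous D := by
    have h3 : Continuous fun s => ∑ j ∈ Finset.range M,
        2 * viscCoef ε₀ νh (N + 1 + j) s * physEnergy ε₀ W (N + 1 + j) s := by
      refine continuous_finsetSum _ fun j _ => ?_
      have : Continuous fun s => viscCoef ε₀ νh (N + 1 + j) s := by unfold viscCoef; fun_prop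
      exact (continuous_const.mul this).mul (cE _)
    simp only [hD]; exact (cFN.sub cFtop).sub h3
  have cT : Continuous T := continuous_iff_continuousAt.2 fun s => (hTderiv s).continuousAt
  set Ψ : ℝ → ℝ := fun s => Real.exp (P s) * T s with hΨ
  set Ψ' : ℝ → ℝ := fun s => Real.exp (P s) * θ s * T s + Real.exp (P s) * D s with hΨ'
  have hΨderiv : ∀ s, HasDerivAt Ψ (Ψ' s) s := fun s => (hPderiv s).exp.mul (hTderiv s)
  have cΨ' : Continuous Ψ' := by have : Continuous fun s => Real.exp (P s) := cP.rexp; simp only [hΨ']; fun_prop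
  set G : ℝ → ℝ := fun s => -(Real.exp (P σ) * |physFlux ε₀ α W N s|) with hG
  have cG : Continuous G := by simp only [hG]; fun_prop
  have hlow : ∀ s ∈ Icc σs σ, G s ≤ Ψ' s := by
    intro s hs
    have heP : 0 < Real.exp (P s) := Real.exp_pos _
    have hePle : Real.exp (P s) ≤ Real.exp (P σ) := Real.exp_le_exp.2 (hPmono s hs)
    have hTs := hTnn s
    have hFtop : physFlux ε₀ α W (N + M) s ≤ κ₀ * ‖W (N + M + 1) s‖ * T s := by
      have h1 := (le_abs_self _).trans (abs_physFlux_le hε hc W (N + M) s)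
      have h2 : 2 * fluxConst α * (bigLam ε₀)⁻¹ * ‖W (N + M + 1) s‖ * physEnergy ε₀ W (N + M) s
          ≤ κ₀ * ‖W (N + M + 1) s‖ * T s := by
        rw [hκ₀]
        exact mul_le_mul_of_nonneg_left (top_physEnergy_le_block W N hM1 s)
          (mul_nonneg hκ₀nn (norm_nonneg _) |>.trans_eq (by rw [hκ₀]))
      exact h1.trans h2
    have hdiss := blockDiss_le_top hε hν W N M s
    have hbot : -|physFlux ε₀ α W N s| ≤ physFlux ε₀ α W N s := neg_abs_le _
    have hsum : -|physFlux ε₀ α W N s| ≤ θ s * T s + D s := by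
      simp only [hθ, hD, hT] at hFtop hdiss ⊢; nlinarith
    have h3 : Real.exp (P s) * (-|physFlux ε₀ α W N s|) ≤ Real.exp (P s) * (θ s * T s + D s) :=
      mul_le_mul_of_nonneg_left hsum heP.le
    have h4 : Real.exp (P s) * |physFlux ε₀ α W N s| ≤ Real.exp (P σ) * |physFlux ε₀ α W N s| :=
      mul_le_mul_of_nonneg_right hePle (abs_nonneg _)
    simp only [hG, hΨ']; nlinarith
  have hftc : ∫ s in σs..σ, Ψ' s = Ψ σ - Ψ σs :=
    intervalIntegral.integral_eq_sub_of_hasDerivAt (fun s _ => hΨderiv s) (cΨ'.intervalIntegrable _ _)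
  have hmono : ∫ s in σs..σ, G s ≤ ∫ s in σs..σ, Ψ' s :=
    intervalIntegral.integral_mono_on hle (cG.intervalIntegrable _ _) (cΨ'.intervalIntegrable _ _) hlow
  have hGint : ∫ s in σs..σ, G s = -(Real.exp (P σ) * ∫ s in σs..σ, |physFlux ε₀ α W N s|) := by
    simp only [hG]; rw [intervalIntegral.integral_neg, intervalIntegral.integral_const_mul]
  have hGge : -(Real.exp (P σ) * Φ) ≤ ∫ s in σs..σ, G s := by
    rw [hGint, neg_le_neg_iff]; exact mul_le_mul_of_nonneg_left hΦ (Real.exp_pos _).le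
  have hΨs : Ψ σs = T σs := by simp [hΨ, hP0]
  have hΨσ : Ψ σ = Real.exp (P σ) * T σ := rfl
  have hkey : T σs - Real.exp (P σ) * Φ ≤ Real.exp (P σ) * T σ := by rw [← hΨσ, ← hΨs]; linarith
  have hdiv : Real.exp (-P σ) * T σs - Φ ≤ T σ := by
    have h := mul_le_mul_of_nonneg_left hkey (Real.exp_pos (-P σ)).le
    have e1 : Real.exp (-P σ) * Real.exp (P σ) = 1 := by rw [← Real.exp_add, neg_add_cancel, Real.exp_zero]
    have e2 : Real.exp (-P σ) * (Real.exp (P σ) * T σ) = T σ := by rw [← mul_assoc, e1, one_mul]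
    have e3 : Real.exp (-P σ) * (T σs - Real.exp (P σ) * Φ) = Real.exp (-P σ) * T σs - Φ := by
      calc Real.exp (-P σ) * (T σs - Real.exp (P σ) * Φ)
          = Real.exp (-P σ) * T σs - (Real.exp (-P σ) * Real.exp (P σ)) * Φ := by ring
        _ = _ := by rw [e1, one_mul]
    rwa [e2, e3] at h
  have hexp : Real.exp (-Θ) ≤ Real.exp (-P σ) := Real.exp_le_exp.2 (by linarith)
  calc Real.exp (-Θ) * T σs - Φ ≤ Real.exp (-P σ) * T σs - Φ := by
        nlinarith [mul_le_mul_of_nonneg_right hexp (hTnn σs)]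
    _ ≤ T σ := hdiv

/-! ## §3 Late starvation of the bottom bond and of the dissipation -/

/-- `∫_{σ₁}^{σ₂} e^{−s} ds = e^{−σ₁} − e^{−σ₂}`. [folklore] -/
theorem integral_exp_neg_eq (σ₁ σ₂ : ℝ) :
    ∫ s in σ₁..σ₂, Real.exp (-s) = Real.exp (-σ₁) - Real.exp (-σ₂) := by
  have hderiv : ∀ x ∈ Set.uIcc σ₁ σ₂, HasDerivAt (fun s => -Real.exp (-s)) (Real.exp (-x)) x := by
    intro x _
    have h := ((hasDerivAt_neg x).exp).neg
    have e : -(Real.exp (-x) * -1) = Real.exp (-x) := by ring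
    rw [e] at h
    exact h
  have h := intervalIntegral.integral_eq_sub_of_hasDerivAt hderiv
    ((by fun_prop : Continuous fun s => Real.exp (-s)).intervalIntegrable _ _)
  rw [h]; ring

/-- **Late starvation of a bond above shell `0`.**  With the uniform energy bound `E_n ≤ K` on the shells `n ≥ 0`, for `N ∈ ℕ` and
`σ₁ ≤ σ₂`: `∫_{σ₁}^{σ₂}|F_N| ≤ 2C_AΛ^N·K√K·e^{−σ₁}` (`|F_N(s)| ≤ 2C_AΛ^N e^{−s}√E_{N+1}·E_N`, tree `abs_physFlux_le_energy`: in log-time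
the physical time `t⋆ − t = e^{−σ}` left for traffic runs out).
[cite: Tao2016AveragedNS, §4 Lemma 4.1 (4.8)–(4.10) with (4.3), §6.4; tree `abs_physFlux_le_energy` + this file] -/
theorem integral_abs_physFlux_late_le (hε : 0 < ε₀) (hW : IsEternalVisc ε₀ νh α W) (hc : IsCancellingCoeff α)
    {K : ℝ} (hK0 : 0 ≤ K) (hK : ∀ (n : ℕ) (σ : ℝ), physEnergy ε₀ W n σ ≤ K) (N : ℕ)
    {σ₁ σ₂ : ℝ} (h12 : σ₁ ≤ σ₂) :
    ∫ s in σ₁..σ₂, |physFlux ε₀ α W N s|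
      ≤ 2 * fluxConst α * bigLam ε₀ ^ (N : ℤ) * (K * Real.sqrt K) * Real.exp (-σ₁) := by
  have hΛ : 0 < bigLam ε₀ := bigLam_pos (by linarith)
  have hC0 := fluxConst_nonneg α
  have hΛN : 0 ≤ bigLam ε₀ ^ (N : ℤ) := (zpow_pos hΛ _).le
  set Cst : ℝ := 2 * fluxConst α * bigLam ε₀ ^ (N : ℤ) * (K * Real.sqrt K) with hCst
  have cFN : Continuous (physFlux ε₀ α W N) := continuous_physFlux hW hc N
  have hpt : ∀ s ∈ Icc σ₁ σ₂, |physFlux ε₀ α W N s| ≤ Cst * Real.exp (-s) := by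
    intro s _
    have h := abs_physFlux_le_energy hε hc W (N : ℤ) s
    have hEN : physEnergy ε₀ W (N : ℤ) s ≤ K := hK N s
    have hEN1 : physEnergy ε₀ W ((N : ℤ) + 1) s ≤ K := by have := hK (N + 1) s; push_cast at this; exact this
    have hsq : Real.sqrt (physEnergy ε₀ W ((N : ℤ) + 1) s) ≤ Real.sqrt K := Real.sqrt_le_sqrt hEN1
    have hEN0 := physEnergy_nonneg ε₀ W (N : ℤ) s
    have hsq0 := Real.sqrt_nonneg (physEnergy ε₀ W ((N : ℤ) + 1) s)
    calc |physFlux ε₀ α W N s|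
        ≤ 2 * fluxConst α * bigLam ε₀ ^ (N : ℤ) * Real.exp (-s)
            * Real.sqrt (physEnergy ε₀ W ((N : ℤ) + 1) s) * physEnergy ε₀ W (N : ℤ) s := h
      _ ≤ 2 * fluxConst α * bigLam ε₀ ^ (N : ℤ) * Real.exp (-s) * Real.sqrt K * K := by
          have h0 : 0 ≤ 2 * fluxConst α * bigLam ε₀ ^ (N : ℤ) * Real.exp (-s) := by positivity
          exact mul_le_mul (mul_le_mul_of_nonneg_left hsq h0) hEN hEN0 (by positivity)
      _ = Cst * Real.exp (-s) := by rw [hCst]; ring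
  have h1 : ∫ s in σ₁..σ₂, |physFlux ε₀ α W N s| ≤ ∫ s in σ₁..σ₂, Cst * Real.exp (-s) :=
    intervalIntegral.integral_mono_on h12 (cFN.abs.intervalIntegrable _ _)
      ((by fun_prop : Continuous fun s => Cst * Real.exp (-s)).intervalIntegrable _ _) hpt
  rw [intervalIntegral.integral_const_mul, integral_exp_neg_eq] at h1
  exact h1.trans (mul_le_mul_of_nonneg_left (by linarith [Real.exp_pos (-σ₂)]) (by positivity))

/-- **Late starvation of the dissipation rate**: `∫_{σ₁}^{σ₂} 2·visc_k(s) ds = 2ν̂(1+ε₀)^{2k}(e^{−σ₁} − e^{−σ₂}) ≤ 2ν̂(1+ε₀)^{2k}e^{−σ₁}`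
(`ν̂ ≥ 0`; any `σ₁, σ₂`).
[cite: Tao2016AveragedNS, §4, the viscous equation displayed before Thm. 4.2, §6.4; elementary] -/
theorem integral_two_viscCoef_le (hε : 0 < ε₀) (hν : 0 ≤ νh) (k : ℤ) (σ₁ σ₂ : ℝ) :
    ∫ s in σ₁..σ₂, 2 * viscCoef ε₀ νh k s ≤ 2 * νh * (1 + ε₀) ^ ((2 : ℝ) * k) * Real.exp (-σ₁) := by
  have hpow : 0 < (1 + ε₀) ^ ((2 : ℝ) * k) := Real.rpow_pos_of_pos (by linarith) _
  have hfun : (fun s => 2 * viscCoef ε₀ νh k s)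
      = fun s => (2 * νh * (1 + ε₀) ^ ((2 : ℝ) * k)) * Real.exp (-s) := by funext s; unfold viscCoef; ring
  rw [hfun, intervalIntegral.integral_const_mul, integral_exp_neg_eq]
  have h0 : 0 ≤ 2 * νh * (1 + ε₀) ^ ((2 : ℝ) * k) := by positivity
  exact mul_le_mul_of_nonneg_left (by linarith [Real.exp_pos (-σ₂)]) h0

/-! ## §4 No block ever empties -/

/-- **NO BLOCK EVER EMPTIES (late block floor).**  For a uniformly bounded admissible eternal solution (any `ν̂ ≥ 0`) of a
cancelling table with the uniform energy bound `E_n ≤ K` (`n ≥ 0`), a block of shells `N+1, …, N+M` above shell `0`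
(`N, M ∈ ℕ`), `σ₁ ≤ σ₂`, and `a ≥ ∫_{σ₁}^{σ₂}‖W_{N+M+1}‖` (the action of the ONE shell above the block on that window):
`exp(−(2C_AΛ⁻¹·a + 2ν̂(1+ε₀)^{2(N+M)}e^{−σ₁}))·Σ_{j<M}E_{N+1+j}(σ₁) − 2C_AΛ^N K√K e^{−σ₁} ≤ Σ_{j<M}E_{N+1+j}(σ₂)`.
Energy handed back down inside the block by backscatter stays in the block.
[cite: Tao2016AveragedNS, §4 Lemma 4.1 (4.8)–(4.10) with (4.3), the viscous equation before Thm. 4.2, §6.4; this file] -/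
theorem blockEnergy_late_ge (hε : 0 < ε₀) (hW : IsEternalVisc ε₀ νh α W) (hc : IsCancellingCoeff α)
    {K : ℝ} (hK0 : 0 ≤ K) (hK : ∀ (n : ℕ) (σ : ℝ), physEnergy ε₀ W n σ ≤ K) (N M : ℕ)
    {σ₁ σ₂ : ℝ} (h12 : σ₁ ≤ σ₂) {a : ℝ} (ha : ∫ s in σ₁..σ₂, ‖W ((N : ℤ) + M + 1) s‖ ≤ a) :
    Real.exp (-(2 * fluxConst α * (bigLam ε₀)⁻¹ * a
          + 2 * νh * (1 + ε₀) ^ ((2 : ℝ) * (((N : ℤ) + M : ℤ) : ℝ)) * Real.exp (-σ₁)))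
        * (∑ j ∈ Finset.range M, physEnergy ε₀ W ((N : ℤ) + 1 + j) σ₁)
        - 2 * fluxConst α * bigLam ε₀ ^ (N : ℤ) * (K * Real.sqrt K) * Real.exp (-σ₁)
      ≤ ∑ j ∈ Finset.range M, physEnergy ε₀ W ((N : ℤ) + 1 + j) σ₂ := by
  have hΛ : 0 < bigLam ε₀ := bigLam_pos (by linarith)
  have hC0 := fluxConst_nonneg α
  have hν : 0 ≤ νh := hW.nonneg
  have hκ₀nn : 0 ≤ 2 * fluxConst α * (bigLam ε₀)⁻¹ := by positivity
  have cWtop : Continuous (W ((N : ℤ) + M + 1)) :=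
    continuous_iff_continuousAt.2 fun s => (hW.law ((N : ℤ) + M + 1) s).continuousAt
  have cvisc : Continuous fun s => viscCoef ε₀ νh ((N : ℤ) + M) s := by unfold viscCoef; fun_prop
  have hΘ : ∫ s in σ₁..σ₂, (2 * fluxConst α * (bigLam ε₀)⁻¹ * ‖W ((N : ℤ) + M + 1) s‖
      + 2 * viscCoef ε₀ νh ((N : ℤ) + M) s)
      ≤ 2 * fluxConst α * (bigLam ε₀)⁻¹ * a
          + 2 * νh * (1 + ε₀) ^ ((2 : ℝ) * (((N : ℤ) + M : ℤ) : ℝ)) * Real.exp (-σ₁) := by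
    rw [intervalIntegral.integral_add ((by fun_prop : Continuous fun s =>
        2 * fluxConst α * (bigLam ε₀)⁻¹ * ‖W ((N : ℤ) + M + 1) s‖).intervalIntegrable _ _)
      ((by fun_prop : Continuous fun s => 2 * viscCoef ε₀ νh ((N : ℤ) + M) s).intervalIntegrable _ _)]
    rw [intervalIntegral.integral_const_mul]
    have h1 : 2 * fluxConst α * (bigLam ε₀)⁻¹ * (∫ s in σ₁..σ₂, ‖W ((N : ℤ) + M + 1) s‖)
        ≤ 2 * fluxConst α * (bigLam ε₀)⁻¹ * a := mul_le_mul_of_nonneg_left ha hκ₀nn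
    exact add_le_add h1 (integral_two_viscCoef_le hε hν ((N : ℤ) + M) σ₁ σ₂)
  exact blockEnergy_ge_floor hε hW hc (N : ℤ) M h12 hΘ (integral_abs_physFlux_late_le hε hW hc hK0 hK N h12)

/-- On a window `[σ₁, σ₂]` the action of a shell is at most its total action `∫_ℝ‖W_k‖` (admissibility clause of `IsEternalVisc`).
[cite: Tao2016AveragedNS, §4 Lemma 4.1 (4.8), §6.4; cell vocabulary (the action bound) — elementary] -/
theorem intervalIntegral_norm_le_action (hW : IsEternalVisc ε₀ νh α W) {𝓜 : ℝ}
    (h𝓜 : ∀ n : ℤ, Integrable (fun σ => ‖W n σ‖) ∧ ∫ σ, ‖W n σ‖ ≤ 𝓜) (k : ℤ) {σ₁ σ₂ : ℝ} (h12 : σ₁ ≤ σ₂) :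
    ∫ s in σ₁..σ₂, ‖W k s‖ ≤ 𝓜 := by
  have _ := hW.nonneg; obtain ⟨hint, hle⟩ := h𝓜 k
  rw [intervalIntegral.integral_of_le h12]
  calc ∫ s in Ioc σ₁ σ₂, ‖W k s‖ ≤ ∫ s, ‖W k s‖ :=
        setIntegral_le_integral hint (Eventually.of_forall fun s => norm_nonneg _)
    _ ≤ 𝓜 := hle

/-- **No block ever empties — uniform form.**  With the admissibility action budget `∫_ℝ‖W_n‖ ≤ 𝓜` in place of the window action:
for ALL `σ₂ ≥ σ₁`, `exp(−(2C_AΛ⁻¹𝓜 + 2ν̂(1+ε₀)^{2(N+M)}e^{−σ₁}))·Σ_{j<M}E_{N+1+j}(σ₁) − 2C_AΛ^N K√K e^{−σ₁} ≤ Σ_{j<M}E_{N+1+j}(σ₂)`.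
[cite: Tao2016AveragedNS, §4 Lemma 4.1 (4.8)–(4.10) with (4.3), the viscous equation before Thm. 4.2, §6.4; this file] -/
theorem blockEnergy_late_ge_of_action (hε : 0 < ε₀) (hW : IsEternalVisc ε₀ νh α W) (hc : IsCancellingCoeff α)
    {K : ℝ} (hK0 : 0 ≤ K) (hK : ∀ (n : ℕ) (σ : ℝ), physEnergy ε₀ W n σ ≤ K)
    {𝓜 : ℝ} (h𝓜 : ∀ n : ℤ, Integrable (fun σ => ‖W n σ‖) ∧ ∫ σ, ‖W n σ‖ ≤ 𝓜)
    (N M : ℕ) {σ₁ σ₂ : ℝ} (h12 : σ₁ ≤ σ₂) :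
    Real.exp (-(2 * fluxConst α * (bigLam ε₀)⁻¹ * 𝓜
          + 2 * νh * (1 + ε₀) ^ ((2 : ℝ) * (((N : ℤ) + M : ℤ) : ℝ)) * Real.exp (-σ₁)))
        * (∑ j ∈ Finset.range M, physEnergy ε₀ W ((N : ℤ) + 1 + j) σ₁)
        - 2 * fluxConst α * bigLam ε₀ ^ (N : ℤ) * (K * Real.sqrt K) * Real.exp (-σ₁)
      ≤ ∑ j ∈ Finset.range M, physEnergy ε₀ W ((N : ℤ) + 1 + j) σ₂ :=
  blockEnergy_late_ge hε hW hc hK0 hK N M h12 (intervalIntegral_norm_le_action hW h𝓜 _ h12)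

/-- **The frozen block wake.**  If the block energy `Σ_{j<M}E_{N+1+j}(σ)` tends to a limit `L` as `σ → ∞` (it does, shell by
shell, by the terminal profile of `…WakeCriterion`; here the limit is a hypothesis), then `L` obeys the late block floor from every
`σ₁`: `exp(−(2C_AΛ⁻¹𝓜 + 2ν̂(1+ε₀)^{2(N+M)}e^{−σ₁}))·Σ_{j<M}E_{N+1+j}(σ₁) − 2C_AΛ^N K√K e^{−σ₁} ≤ L`.
[cite: Tao2016AveragedNS, §4 Lemma 4.1 (4.8)–(4.10) with (4.3), the viscous equation before Thm. 4.2, §6.4; this file] -/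
theorem blockTerminal_ge (hε : 0 < ε₀) (hW : IsEternalVisc ε₀ νh α W) (hc : IsCancellingCoeff α)
    {K : ℝ} (hK0 : 0 ≤ K) (hK : ∀ (n : ℕ) (σ : ℝ), physEnergy ε₀ W n σ ≤ K)
    {𝓜 : ℝ} (h𝓜 : ∀ n : ℤ, Integrable (fun σ => ‖W n σ‖) ∧ ∫ σ, ‖W n σ‖ ≤ 𝓜)
    (N M : ℕ) {L : ℝ}
    (hL : Tendsto (fun σ : ℝ => ∑ j ∈ Finset.range M, physEnergy ε₀ W ((N : ℤ) + 1 + j) σ) atTop (𝓝 L))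
    (σ₁ : ℝ) :
    Real.exp (-(2 * fluxConst α * (bigLam ε₀)⁻¹ * 𝓜
          + 2 * νh * (1 + ε₀) ^ ((2 : ℝ) * (((N : ℤ) + M : ℤ) : ℝ)) * Real.exp (-σ₁)))
        * (∑ j ∈ Finset.range M, physEnergy ε₀ W ((N : ℤ) + 1 + j) σ₁)
        - 2 * fluxConst α * bigLam ε₀ ^ (N : ℤ) * (K * Real.sqrt K) * Real.exp (-σ₁) ≤ L :=
  ge_of_tendsto hL (Filter.eventually_atTop.2 ⟨σ₁, fun _ h12 =>
    blockEnergy_late_ge_of_action hε hW hc hK0 hK h𝓜 N M h12⟩)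

/-! ## §5 A survival event never evaporates -/

/-- Dictionary: the a=1-weighted renormalised energy of a shell `n ∈ ℕ` is `(1+ε₀)^n` times its physical energy,
`physWeight(1)^n·e^{2σ}‖W_n(σ)‖² = (1+ε₀)^n·E_n(σ)` (tree `wtEnergy_eq`).
[cite: Tao2016AveragedNS, §4 (4.1), Lemma 4.1 (4.10), §6.4; tree `wtEnergy_eq`] -/
theorem weighted_eq_pow_mul_physEnergy (hε : 0 < ε₀) (W : ℤ → ℝ → Em m) (n : ℕ) (σ : ℝ) :
    physWeight 1 ε₀ ^ n * (Real.exp (2 * σ) * ‖W n σ‖ ^ 2) = (1 + ε₀) ^ n * physEnergy ε₀ W n σ := by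
  have h := wtEnergy_eq hε W n σ
  unfold wtEnergy at h
  exact h

/-- **A SURVIVAL EVENT NEVER EVAPORATES.**  For a uniformly bounded admissible eternal solution (any `ν̂ ≥ 0`) of a cancelling
table with the uniform energy bound `E_n ≤ K` (`n ≥ 0`) and action budget `∫_ℝ‖W_n‖ ≤ 𝓜`: if at some shell `n ≥ 1` and log-time
`σ` the a=1-weighted energy reaches a level `c`, `c ≤ physWeight(1)^n·e^{2σ}‖W_n(σ)‖²`, then at EVERY later log-time `σ₂ ≥ σ` the
shells `1, …, n` together still hold physical energy
`Σ_{j<n}E_{1+j}(σ₂) ≥ exp(−(2C_AΛ⁻¹𝓜 + 2ν̂(1+ε₀)^{2n}e^{−σ}))·c·((1+ε₀)^n)⁻¹ − 2C_A K√K e^{−σ}` — on EVERY cancelling table,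
backscatter notwithstanding.
[cite: Tao2016AveragedNS, §4 Lemma 4.1 (4.8)–(4.10) with (4.3), the viscous equation before Thm. 4.2, §6.4; this file] -/
theorem survivalEvent_blockWake (hε : 0 < ε₀) (hW : IsEternalVisc ε₀ νh α W) (hc : IsCancellingCoeff α)
    {K : ℝ} (hK0 : 0 ≤ K) (hK : ∀ (n : ℕ) (σ : ℝ), physEnergy ε₀ W n σ ≤ K)
    {𝓜 : ℝ} (h𝓜 : ∀ n : ℤ, Integrable (fun σ => ‖W n σ‖) ∧ ∫ σ, ‖W n σ‖ ≤ 𝓜)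
    {n : ℕ} (hn : 1 ≤ n) {σ : ℝ} {c : ℝ}
    (hev : c ≤ physWeight 1 ε₀ ^ n * (Real.exp (2 * σ) * ‖W n σ‖ ^ 2))
    {σ₂ : ℝ} (h2 : σ ≤ σ₂) :
    Real.exp (-(2 * fluxConst α * (bigLam ε₀)⁻¹ * 𝓜
          + 2 * νh * (1 + ε₀) ^ ((2 : ℝ) * ((n : ℤ) : ℝ)) * Real.exp (-σ))) * (c * ((1 + ε₀) ^ n)⁻¹)
        - 2 * fluxConst α * (K * Real.sqrt K) * Real.exp (-σ)
      ≤ ∑ j ∈ Finset.range n, physEnergy ε₀ W ((0 : ℕ) + 1 + j : ℤ) σ₂ := by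
  have hx : 0 < (1 + ε₀) ^ n := pow_pos (by linarith) n
  -- the event in physical currency: `c·(1+ε₀)^{-n} ≤ E_n(σ)`
  have hEn : c * ((1 + ε₀) ^ n)⁻¹ ≤ physEnergy ε₀ W n σ := by
    rw [weighted_eq_pow_mul_physEnergy hε W n σ] at hev
    rw [mul_inv_le_iff₀ hx]
    linarith
  -- the block `1, …, n` (`N = 0`, `M = n`) contains shell `n`
  have hblock : physEnergy ε₀ W n σ ≤ ∑ j ∈ Finset.range n, physEnergy ε₀ W ((0 : ℕ) + 1 + j : ℤ) σ := by
    have h := top_physEnergy_le_block (ε₀ := ε₀) W ((0 : ℕ) : ℤ) hn σ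
    simpa using h
  have hmain := blockEnergy_late_ge_of_action hε hW hc hK0 hK h𝓜 0 n h2
  -- compare the two floors
  have hcast : (((0 : ℕ) : ℤ) + (n : ℤ) : ℤ) = (n : ℤ) := by simp
  simp only [Nat.cast_zero, zero_add, zpow_zero, mul_one] at hmain
  have hexp0 : 0 ≤ Real.exp (-(2 * fluxConst α * (bigLam ε₀)⁻¹ * 𝓜
      + 2 * νh * (1 + ε₀) ^ ((2 : ℝ) * ((n : ℤ) : ℝ)) * Real.exp (-σ))) := (Real.exp_pos _).le
  have hle := mul_le_mul_of_nonneg_left (hEn.trans hblock) hexp0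
  have hblock' : ∑ j ∈ Finset.range n, physEnergy ε₀ W ((0 : ℕ) + 1 + j : ℤ) σ
      = ∑ j ∈ Finset.range n, physEnergy ε₀ W (1 + (j : ℤ)) σ := by simp
  have hgoal : ∑ j ∈ Finset.range n, physEnergy ε₀ W ((0 : ℕ) + 1 + j : ℤ) σ₂
      = ∑ j ∈ Finset.range n, physEnergy ε₀ W (1 + (j : ℤ)) σ₂ := by simp
  rw [hgoal]
  rw [hblock'] at hle
  linarith
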